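import Summits.HubbardSuperconductivity.HubbardSuperconductivity.Theorems.AnisotropyChordTransferFibre3KT1Targets
import Summits.HubbardSuperconductivity.HubbardSuperconductivity.Theorems.AnisotropyChordTransferFibre3BetaFreeTargets
import Summits.HubbardSuperconductivity.HubbardSuperconductivity.Theorems.AnisotropyChordTransferFibre3B1Objects
import Summits.HubbardSuperconductivity.HubbardSuperconductivity.Theorems.AnisotropyChordTransferFibre3KernelWindow

/-!
# Route `AnisotropyChord` / H0 rotor rung: PORT PartN41-D — the KT-2a row (`LowShellGFormAbs`) of the LEVEL-2 certificate
(piece A, `∀ L ≥ 128`): objects, the cancelled recipe `RhatCancelled`, convolution expansion, boundary lines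

Port (verbatim modulo this header) of the theory seat's statement file `hubbard-h0-rotor-theory-1/cycle22/lean/PartN41D.lean`
(sha16 `f9d33daff9cf868d`; theory seat `hubbard-h0-rotor-theory-1` g22, REPORT 2 (revision) 04:02Z and REPORT 5 = WRAP-UP
04:16Z; memo ROTOR-THEORY-22 §339–§341; cycle22/lean/PORT-INDEX.md).  Statements only (`def … : Prop` = TARGETS, plain
`def` = objects; nothing is proved here; §2 "one-loop" is documentation only per theory REPORT 2 — evaluate the row through §3
`RhatCancelled`).  Ported by prover seat `hubbard-h0-rotor-p1` g26; `--supports stmt-HubbardSuperconductivity-23918`.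
WHAT THIS IS NOT: nothing here proves superconductivity in the Hubbard model.

ORIGINAL MODULE DOCSTRING (theory-1 g22):

# PartN41-D — the KT-2a row (`LowShellGFormAbs`: `lowG ≤ a·η_eff·U`) of the LEVEL-2 certificate of piece A (`∀ L ≥ 128`):
the 45 low-shell residual coefficients `R̂′(k₂,k₃)` at ONE LOOP, reduced to the NAMED objects of PartN41-B
(theory-1 g22, memo 22 §339; LEVEL2-SPEC §3 row "45 low-shell coefficients"; transcribes cycle21/calc/oneloop_kt2a.py,
which was verified against the brute-force coefficients of `lib21.three_body` to 7e-11, memo 21 §297(C)/§298(a))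

STATEMENT FILE (`def … : Prop` = TARGET).  The row is `hKT2a` of `gm3_allL_window`, assembled by p1's
`KT2Assembly.lowShellGFormAbs_of_brackets` from ONE bracket `lowG ≤ Ghi`.  Content:
* `R̂′(k) := cfgDFT R′ (k₂,k₃)` for the off-`D` residual `R′ = 1_{Dᶜ}(H^{K₁} − ΔW − ε₁ − T⁺)Ψ¹`, `Ψ¹ = v·Π⁰`, splits as
  `R̂′ = den(k)·Ψ̂¹(k) − Δ·FTW(k) + Bd(k)` (free part in Fourier; interaction `W`; the hard-core boundary `1_D H₀Ψ¹`), where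
  `Ψ̂¹(k₂,k₃) = Π̂(k₂,k₃) + Π̂(k₂−K₁,k₃) + Π̂(k₂,k₃−K₁)`, `Π̂ = cfgDFT Π⁰ = (1/V)Σ_p f̂(p)f̂(q₂+p)f̂(q₃−p)` and `FTW`, `Bd` are
  finite combinations of the pair transforms `Y_e(q) := FT[f·f(·−e)](q) = F̂₂(q) − φ̂_e(q)` at the ≤ 6 momenta
  `k₂, k₃, k₂−K₁, k₃−K₁, k₂+k₃, k₂+k₃−K₁` (all `|·|∞ ≤ 3`), with coefficients `f_nn`, `e^{±iθ}`-phases;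
* `f̂(p) = (V + a)δ_{p,0} − a − c_s g(p)` (`TwoMagnonFourier`), so `Π̂(q₂,q₃)` is a polynomial in `V, a, c_s g(q)` (closed),
  `c_s S₁ = V − a(V − 1)` (closed), two- and three-propagator `B1.torSum`s with shifts in `{0, ±q₂, ±q₃, q₂+q₃}` (`PiHatExpansion`);
* `F₂ = c + t`, `φ̂_e = μ_e + ½(1 − z_e)t + ½τ_e` (PartN41-B `F2ClosedPlusTail`, `PhiHatClosedPlusTail`): NAMED for `|q|∞ ≤ 1`,
  and enclosed per momentum by the block intervals (`TauTailBoundC`, `PhiHatNearClosed`) for `|q|∞ ≤ 6`;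
* `den(T⁺; k) = ε(K₁−k₂−k₃) + ε(k₂) + ε(k₃) − ε₁ − T⁺` explicit in `θ` with `T⁺ ∈ [Tlo, Thi]` (PartN41-B `TplusFromPC0`);
  on the low set `den ≥ 2ε₁ − Thi > 0`.
Budget: `a″ = lowG/(η_eff U) = .037/.037/.040` at `L = 128` (`Δ = .1/.5/.95`); the certificate tolerates `a″ ≤ 0.19` (×5).  This row
cannot be dropped or merged into the KT-2b budget (memo 22 §338(e)).

★ WARNING (measured, cycle22/calc/rowD_cancellation.py): the three pieces of §2's `RhatOneLoop` — `den·Ψ̂¹`, `Δ·FTW`, `Bd` — are EACH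
10–3000× larger than `R̂′` and cancel (lowG from `Σ|piece|` would be ×82 / ×301 / ×36290 too large at `L = 32`, `Δ = .1/.5/.95`).
§2 is a true identity but NOT an evaluation recipe.  THE EVALUATION FORM IS §3 (the CANCELLED form, memo 20's N/M split):
`R′ = v·C0′ + M` with `C0′ = C0 − (T⁺ − 3λ₂)Π⁰` (the `K = 0` residual, `O(∇f·∇f)` by `C0Explicit`) and the spectator term
`M = −½ Σ_{e=±x̂} (e^{iθeₓ} − 1)[(Π⁰(a−e,b−e) − Π⁰) + e^{iθaₓ}(Π⁰(a+e,b) − Π⁰) + e^{iθbₓ}(Π⁰(a,b+e) − Π⁰)]` (`O(θ·∇Π⁰)`);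
both are TRILINEAR in the three pair factors at positions `a, b, b−a`, and with the profile split `f = f_JU + f_S`
(`f_JU = a(1 − δ₀)` = uniform-with-hole, `f_S = c_s a_λ` smooth, `O(η)`) the pure-jump monomial `(JU,JU,JU)` VANISHES IDENTICALLY
off `D` for both forms (`C0FormJU`, `MFormJU`), so every surviving monomial carries a factor `f_S` and is naturally sized:
measured `|monomial| ≤ 1.05·|R̂′|`, `|all-c convolution|, |D-boundary| ≤ 2.3·|R̂′|` on the whole low set (`L = 12`, `Δ = .1/.5/.95`;
rowD_monomials.py), and `lowG` from `|N̂| + |M̂|` is only ×1.36/1.32/1.06 of the truth (rowD_cancelled.py).  Each monomial is a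
one-loop convolution (`TripleConvolution`) of `f̂_JU = aVδ₀ − a`, `f̂_S = (V(1−a)+a)δ₀ − c_s g` with `d_e`-weights `(1 − e^{−iq·e})`,
minus a boundary sum over the three lines of `D` (pair transforms) — i.e. closed terms + weighted one/two/three-propagator
`B1.torSum`s with shifts `|·|∞ ≤ 3`, exactly the objects of PartN41-B and of p2's weighted bracket.  §4 makes this explicit: `ConvExpansion` expands any
convolution of three factor specs `(w, α, β, γ)` into 7 closed δ-terms + `Σ_{A ⊆ weights} ± phase · Σ_{8 patterns} Eprim r_A S`
(`Eprim r S = (1/V)Σ_p e^{−ip·r}Π_{s∈S} g(p+s)`, the trig-weighted primitive; conv_expansion.py 2e-15), with the link lemmas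
`DgradTransform`, `C0MonoTransform`, `MFormTransform`, `SlotSpecs`; §5 gives the D-boundary sums in named form (`BoundaryLines`: three
lines × pair transforms `pairZ` = two-factor convolutions, `PairConvolution`, `ShiftTransform`; boundary_lines.py 1e-14).  With §3–§5 the
KT-2a row is explicit down to closed terms and primitives `Eprim r S` (|r|∞ ≤ 3, |S| ≤ 3) — nothing is left for the evaluator to derive.
-/

set_option linter.dupNamespace false
set_option autoImplicit false

noncomputable section

open scoped BigOperators
open Complex

namespace Summit.HubbardSuperconductivity.HubbardSuperconductivity.Theorems.AnisotropyChord.Transfer.Fibre3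

variable (L : ℕ) [NeZero L]

/-! ## §1 Objects -/

/-- `Π̂(q₂,q₃) := cfgDFT Π⁰`. -/
def PiHat (f : Tor L → ℝ) (q₂ q₃ : Tor L) : ℂ := cfgDFT L (prodState L f) q₂ q₃

/-- `Ψ̂¹(k₂,k₃) = Π̂(k₂,k₃) + Π̂(k₂−K₁,k₃) + Π̂(k₂,k₃−K₁)` (`v = 1 + e^{iK₁·a} + e^{iK₁·b}`). -/
def PsiHat1 (f : Tor L → ℝ) (k₂ k₃ : Tor L) : ℂ := PiHat L f k₂ k₃ + PiHat L f (k₂ - K1 L) k₃ + PiHat L f k₂ (k₃ - K1 L)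

/-- the pair transform `Y_e(q) := Σ_b e^{−iq·b} f(b) f(b − e)`. -/
def Yfun (f : Tor L → ℝ) (e q : Tor L) : ℂ := dft L (fun b => f b * f (b - e)) q

/-- the non-delta part of `f̂`: `B(p) := −a − c_s g(p)` (`B(0) = −a`). -/
def Bhat (Δ lam2 : ℝ) (f : Tor L → ℝ) (p : Tor L) : ℝ := -(Δ * f (K1 L)) - cS L Δ lam2 f * gres L lam2 p

/-- `FTW(k) := FT[W Ψ¹]` off `D` in pair transforms (oneloop_kt2a `FTW`). -/
def FTWfun (f : Tor L → ℝ) (k₂ k₃ : Tor L) : ℂ :=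
  (f (K1 L) : ℂ) * ((nnList L).map (fun e =>
      (starRingEnd ℂ) (phase L k₂ e) * ((1 + phase L (K1 L) e) * Yfun L f e k₃ + Yfun L f e (k₃ - K1 L))
    + (starRingEnd ℂ) (phase L k₃ e) * ((1 + phase L (K1 L) e) * Yfun L f e k₂ + Yfun L f e (k₂ - K1 L))
    + (starRingEnd ℂ) (phase L k₃ e) * (Yfun L f (-e) (k₂ + k₃) + (1 + phase L (K1 L) e) * Yfun L f (-e) (k₂ + k₃ - K1 L)))).sum

/-- `Bd(k) := −FT[1_D H₀Ψ¹]` in pair transforms (oneloop_kt2a `Bd`). -/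
def Bdfun (f : Tor L → ℝ) (k₂ k₃ : Tor L) : ℂ :=
  (f (K1 L) : ℂ) * ((nnList L).map (fun e =>
      (1 + phase L (K1 L) e) * (Yfun L f e k₂ + Yfun L f e k₃) + Yfun L f e (k₂ - K1 L) + Yfun L f e (k₃ - K1 L)
    + Yfun L f (-e) (k₂ + k₃) + (1 + phase L (K1 L) e) * Yfun L f (-e) (k₂ + k₃ - K1 L))).sum

/-! ## §2 Targets -/

/-- `f̂` CLOSED (`TwoMagnonFourier` + `Σ f = V`): `f̂(0) = V`, `f̂(p) = −a − c_s g(p)` (`p ≠ 0`), i.e. `f̂ = (V+a)δ₀ + B`. -/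
def FhatClosed (Δ : ℝ) : Prop :=
  ∀ lam2 : ℝ, ∀ f : Tor L → ℝ, 3 ≤ L → IsTwoMagnon L Δ lam2 f → 0 < lam2 → ∀ p : Tor L,
    dft L f p = (((if p = 0 then (L : ℝ) ^ 2 + Δ * f (K1 L) else 0) + Bhat L Δ lam2 f p : ℝ) : ℂ)

/-- `Π̂` AS A ONE-LOOP CONVOLUTION: `Π̂(q₂,q₃) = (1/V) Σ_p f̂(p) f̂(q₂+p) f̂(q₃−p)`. -/
def PiHatConvolution : Prop :=
  ∀ f : Tor L → ℝ, ∀ q₂ q₃ : Tor L,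
    PiHat L f q₂ q₃ = (∑ p : Tor L, dft L f p * dft L f (q₂ + p) * dft L f (q₃ - p)) / (L : ℂ) ^ 2

/-- ★ `Π̂` EXPANDED (`A := V + a`, `B` even): `V·Π̂(q₂,q₃) = A³[q₂=0][q₃=0] + A²([q₂=0]B(q₃) + [q₃=0]B(q₂) + [q₂+q₃=0]B(q₂))
 + A(B(q₂)B(q₃) + B(q₂)B(q₂+q₃) + B(q₃)B(q₂+q₃)) + Σ_p B(p)B(p+q₂)B(p−q₃)`, and the last sum is
`−(V a³ + 3a² c_s S₁ + a c_s²[T(q₂) + T(q₃) + T(q₂+q₃)] + c_s³ Σ_p g(p)g(p+q₂)g(p−q₃))`, `T(q) := Σ_p g(p)g(p+q)`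
(`B1.torSum` instances; `c_s S₁ = V − a(V−1)` closed). -/
def PiHatExpansion (Δ : ℝ) : Prop :=
  ∀ lam2 : ℝ, ∀ f : Tor L → ℝ, 3 ≤ L → IsTwoMagnon L Δ lam2 f → 0 < lam2 → ∀ q₂ q₃ : Tor L,
    let A : ℝ := (L : ℝ) ^ 2 + Δ * f (K1 L)
    let B : Tor L → ℝ := Bhat L Δ lam2 f
    ((L : ℂ) ^ 2) * PiHat L f q₂ q₃
      = ((A ^ 3 * (if q₂ = 0 then 1 else 0) * (if q₃ = 0 then 1 else 0)
          + A ^ 2 * ((if q₂ = 0 then B q₃ else 0) + (if q₃ = 0 then B q₂ else 0) + (if q₂ + q₃ = 0 then B q₂ else 0))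
          + A * (B q₂ * B q₃ + B q₂ * B (q₂ + q₃) + B q₃ * B (q₂ + q₃))
          + ∑ p : Tor L, B p * B (p + q₂) * B (p - q₃) : ℝ) : ℂ) ∧
    (∑ p : Tor L, B p * B (p + q₂) * B (p - q₃))
      = -((L : ℝ) ^ 2 * (Δ * f (K1 L)) ^ 3
          + 3 * (Δ * f (K1 L)) ^ 2 * cS L Δ lam2 f * ∑ p : Tor L, gres L lam2 p
          + (Δ * f (K1 L)) * cS L Δ lam2 f ^ 2 *
              ((∑ p : Tor L, gres L lam2 p * gres L lam2 (p + q₂)) + (∑ p : Tor L, gres L lam2 p * gres L lam2 (p - q₃))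
                + ∑ p : Tor L, gres L lam2 (p + q₂) * gres L lam2 (p - q₃))
          + cS L Δ lam2 f ^ 3 * ∑ p : Tor L, gres L lam2 p * gres L lam2 (p + q₂) * gres L lam2 (p - q₃))

/-- `Y_e = F̂₂ − φ̂_e` (`f(b)f(b−e) = f(b)² − f(b)D_e f(b)`). -/
def YfunSplit : Prop :=
  ∀ f : Tor L → ℝ, ∀ e q : Tor L, Yfun L f e q = dft L (fun b => f b ^ 2) q - phiHat L f e q

/-- ★ THE ONE-LOOP FORM of the residual coefficients (any `k₂ k₃`; used on the 45-point low set):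
`R̂′(k₂,k₃) = den(T⁺;k)·Ψ̂¹(k) − Δ·FTW(k) + Bd(k)`. -/
def RhatOneLoop (Δ : ℝ) : Prop :=
  ∀ lam2 : ℝ, ∀ f : Tor L → ℝ, 3 ≤ L → IsTwoMagnon L Δ lam2 f → (∀ r : Tor L, f (-r) = f r) → ∀ k₂ k₃ : Tor L,
    cfgDFT L (resid L Δ f) k₂ k₃
      = ((den L (Tplus L Δ f) k₂ k₃ : ℝ) : ℂ) * PsiHat1 L f k₂ k₃ - (Δ : ℂ) * FTWfun L f k₂ k₃ + Bdfun L f k₂ k₃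

/-- the low set is an explicit `L`-independent list of 45 integer points for `L ≥ 8` (`Σ|m_i|² ∈ {3,5}`, non-pole). -/
def lowList : List ((ℤ × ℤ) × (ℤ × ℤ)) :=
  [((-1,0),(1,0)), ((0,-1),(0,0)), ((0,-1),(0,1)), ((0,-1),(1,0)), ((0,-1),(1,1)), ((0,0),(0,-1)), ((0,0),(0,1)),
   ((0,0),(1,-1)), ((0,0),(1,1)), ((0,1),(0,-1)), ((0,1),(0,0)), ((0,1),(1,-1)), ((0,1),(1,0)), ((1,-1),(0,0)),
   ((1,-1),(0,1)), ((1,0),(-1,0)), ((1,0),(0,-1)), ((1,0),(0,1)), ((1,0),(1,0)), ((1,1),(0,-1)), ((1,1),(0,0)),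
   ((-1,-1),(1,0)), ((-1,-1),(1,1)), ((-1,0),(0,0)), ((-1,0),(1,-1)), ((-1,0),(1,1)), ((-1,0),(2,0)), ((-1,1),(1,-1)),
   ((-1,1),(1,0)), ((0,0),(-1,0)), ((0,0),(2,0)), ((1,-1),(-1,0)), ((1,-1),(-1,1)), ((1,-1),(1,0)), ((1,-1),(1,1)),
   ((1,0),(-1,-1)), ((1,0),(-1,1)), ((1,0),(1,-1)), ((1,0),(1,1)), ((1,1),(-1,-1)), ((1,1),(-1,0)), ((1,1),(1,-1)),
   ((1,1),(1,0)), ((2,0),(-1,0)), ((2,0),(0,0))]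

/-- `lowSet` = the image of `lowList` (`L ≥ 8`). -/
def LowSetExplicit : Prop :=
  8 ≤ L → lowSet L = (lowList.map (fun mm => (B1.toTor L mm.1, B1.toTor L mm.2))).toFinset

/-- ★ ROW FORM: `lowG = Σ_{45} |den·Ψ̂¹ − Δ·FTW + Bd|² / (V² den)` with `den(k) ≥ 2ε₁ − T⁺` on the low set
(so `Ghi :=` the cell maximum of the right-hand side, every `Y`, `Π̂` enclosed by PartN41-B brackets, is admissible in
`KT2Assembly.lowShellGFormAbs_of_brackets`). -/
def LowGRowForm (Δ : ℝ) : Prop :=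
  ∀ lam2 : ℝ, ∀ f : Tor L → ℝ, 8 ≤ L → IsGroundTwoMagnon L Δ lam2 f →
    lowGForm L Δ f
      = ∑ k ∈ lowSet L, Complex.normSq
          (((den L (Tplus L Δ f) k.1 k.2 : ℝ) : ℂ) * PsiHat1 L f k.1 k.2 - (Δ : ℂ) * FTWfun L f k.1 k.2 + Bdfun L f k.1 k.2)
          / (((L : ℝ) ^ 2) ^ 2 * den L (Tplus L Δ f) k.1 k.2) ∧
    (∀ k ∈ lowSet L, 2 * eps1 L - Tplus L Δ f ≤ den L (Tplus L Δ f) k.1 k.2)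

/-! ## §3 THE CANCELLED FORM `R′ = v·C0′ + M` and its monomial split (USE THIS FOR EVALUATION) -/

/-- the uniform-with-hole part of the profile: `f_JU = a(1 − δ₀)`, `a = Δ f_nn`. -/
def fJU (Δ : ℝ) (f : Tor L → ℝ) : Tor L → ℝ := fun r => if r = 0 then 0 else Δ * f (K1 L)

/-- the smooth part `f_S := f − f_JU` (`= c_s a_λ` off the origin for the ground profile; `f_S(0) = 0`). -/
def fS (Δ : ℝ) (f : Tor L → ℝ) : Tor L → ℝ := fun r => f r - fJU L Δ f r

/-- the 12-term `C0` formula as a TRILINEAR form in the three pair factors sitting at `a` (`Fa`), `b` (`Fb`), `b − a` (`Fc`)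
(`c0form3 f f f c = C0fn c` off `D` by `C0Explicit`). -/
def c0form3 (Fa Fb Fc : Tor L → ℝ) (c : Cfg L) : ℝ :=
  -(1 / 2) * ((nnList L).map (fun e =>
      Fc (c.2 - c.1) * Dgrad L Fa e c.1 * Dgrad L Fb e c.2
    + Fb c.2 * Dgrad L Fa (-e) c.1 * Dgrad L Fc e (c.2 - c.1)
    + Fa c.1 * Dgrad L Fb e c.2 * Dgrad L Fc e (c.2 - c.1))).sum

/-- the trilinear product state `Π(Fa,Fb,Fc)(a,b) = Fa(a) Fb(b) Fc(b−a)`. -/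
def prod3 (Fa Fb Fc : Tor L → ℝ) (c : Cfg L) : ℝ := Fa c.1 * Fb c.2 * Fc (c.2 - c.1)

/-- the spectator term `M` as a trilinear form: `−½ Σ_{e=±x̂} (e^{iθeₓ} − 1)[(Π(a−e,b−e) − Π) + e^{iθaₓ}(Π(a+e,b) − Π) + e^{iθbₓ}(Π(a,b+e) − Π)]`
(the `e = ±ŷ` terms vanish since `e^{iK₁·e} = 1`). -/
def mform3 (Fa Fb Fc : Tor L → ℝ) (c : Cfg L) : ℂ :=
  -(1 / 2) * (([ex L, -(ex L)] : List (Tor L)).map (fun e =>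
      (phase L (K1 L) e - 1) *
        ( ((prod3 L Fa Fb Fc (c.1 - e, c.2 - e) - prod3 L Fa Fb Fc c : ℝ) : ℂ)
        + phase L (K1 L) c.1 * ((prod3 L Fa Fb Fc (c.1 + e, c.2) - prod3 L Fa Fb Fc c : ℝ) : ℂ)
        + phase L (K1 L) c.2 * ((prod3 L Fa Fb Fc (c.1, c.2 + e) - prod3 L Fa Fb Fc c : ℝ) : ℂ)))).sum

/-- ★ THE SPLIT (exact, any two-magnon `f`; lib21 `chkM`, rowD_cancelled.py 1e-13): off `D`,
`R′ = v·(C0fn − (T⁺ − 3λ₂)Π⁰) + M`; on `D` both sides vanish. -/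
def ResidSplit (Δ : ℝ) : Prop :=
  ∀ lam2 : ℝ, ∀ f : Tor L → ℝ, 3 ≤ L → IsTwoMagnon L Δ lam2 f → (∀ r : Tor L, f (-r) = f r) → ∀ c : Cfg L, InD L c = false →
    resid L Δ f c
      = vfun L c * (((C0fn L Δ lam2 f c - (Tplus L Δ f - 3 * lam2) * piR L f c : ℝ) : ℂ)) + mform3 L f f f c

/-- ★ FACT 1: the pure-jump monomial of the `C0` form vanishes off `D` (two hard-core jumps force `c ∈ D`; pure algebra, any `Δ`, `f`). -/
def C0FormJU (Δ : ℝ) : Prop :=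
  ∀ f : Tor L → ℝ, ∀ c : Cfg L, InD L c = false → c0form3 L (fJU L Δ f) (fJU L Δ f) (fJU L Δ f) c = 0

/-- ★ FACT 2: the pure-jump monomial of the spectator form vanishes off `D` as well (each entry-into-`D` event pairs with the
opposite move, phases `(e^{iθ} − 1) + e^{iθ}(e^{−iθ} − 1) = 0`; checked to 1e-15 at every `k`, incl. poles). -/
def MFormJU (Δ : ℝ) : Prop :=
  ∀ f : Tor L → ℝ, 2 ≤ L → ∀ c : Cfg L, InD L c = false → mform3 L (fJU L Δ f) (fJU L Δ f) (fJU L Δ f) c = 0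

/-- the eight monomials `(Pa,Pb,Pc) ∈ {JU,S}³` as a list of slot choices (`true = S`), WITHOUT `(JU,JU,JU)`. -/
def monoList : List (Bool × Bool × Bool) :=
  [(false,false,true), (false,true,false), (false,true,true), (true,false,false), (true,false,true), (true,true,false), (true,true,true)]

/-- slot profile: `S ↦ f_S`, `JU ↦ f_JU`. -/
def slot (Δ : ℝ) (f : Tor L → ℝ) (b : Bool) : Tor L → ℝ := if b then fS L Δ f else fJU L Δ f

/-- ★ THE CANCELLED ONE-LOOP FORM of the low coefficients: by trilinearity + FACT 1/2,
`R̂′(k) = Σ_{7 monomials} cfgDFT[1_{Dᶜ}·(v·c0form3 + mform3)(slots)](k) − (T⁺ − 3λ₂)·Ψ̂¹(k)`. -/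
def RhatCancelled (Δ : ℝ) : Prop :=
  ∀ lam2 : ℝ, ∀ f : Tor L → ℝ, 3 ≤ L → IsTwoMagnon L Δ lam2 f → (∀ r : Tor L, f (-r) = f r) → ∀ k₂ k₃ : Tor L,
    cfgDFT L (resid L Δ f) k₂ k₃
      = (monoList.map (fun m =>
          cfgDFT L (fun c => if InD L c then 0 else
              vfun L c * ((c0form3 L (slot L Δ f m.1) (slot L Δ f m.2.1) (slot L Δ f m.2.2) c : ℝ) : ℂ)
              + mform3 L (slot L Δ f m.1) (slot L Δ f m.2.1) (slot L Δ f m.2.2) c) k₂ k₃)).sum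
        - (((Tplus L Δ f - 3 * lam2 : ℝ) : ℂ)) * PsiHat1 L f k₂ k₃

/-- the off-`D` transform = full transform − boundary sum over the three lines of `D` (`a = 0`, `b = 0`, `a = b`; inclusion–exclusion
at `c = (0,0)`). -/
def OffDTransform : Prop :=
  ∀ G : Cfg L → ℂ, ∀ k₂ k₃ : Tor L,
    cfgDFT L (fun c => if InD L c then 0 else G c) k₂ k₃
      = cfgDFT L G k₂ k₃
        - ((∑ b : Tor L, (starRingEnd ℂ) (phase L k₃ b) * G (0, b))
           + (∑ a : Tor L, (starRingEnd ℂ) (phase L k₂ a) * G (a, 0))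
           + (∑ a : Tor L, (starRingEnd ℂ) (phase L k₂ a * phase L k₃ a) * G (a, a))
           - 2 * G (0, 0))

/-- ★ TRIPLE CONVOLUTION (generalises `PiHatConvolution`): for `G(a,b) = g₁(a) g₂(b) g₃(b − a)`,
`cfgDFT G (k₂,k₃) = (1/V) Σ_p ĝ₃(p) ĝ₁(k₂ + p) ĝ₂(k₃ − p)`; with `v`: `cfgDFT (v·G)(k) = Ĝ(k₂,k₃) + Ĝ(k₂−K₁,k₃) + Ĝ(k₂,k₃−K₁)`.
Applied slotwise to `c0form3`/`mform3` monomials with `FT[D_e F](q) = (1 − e^{−iq·e}) F̂(q)`, `f̂_JU = aVδ₀ − a`,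
`f̂_S = (V(1−a) + a)δ₀ − c_s g` (`ProfileTransforms`), every monomial is closed + weighted `B1.torSum`s (shifts `|·|∞ ≤ 3`). -/
def TripleConvolution : Prop :=
  ∀ g₁ g₂ g₃ : Tor L → ℝ, ∀ k₂ k₃ : Tor L,
    cfgDFT L (fun c => ((prod3 L g₁ g₂ g₃ c : ℝ) : ℂ)) k₂ k₃
      = (∑ p : Tor L, dft L g₃ p * dft L g₁ (k₂ + p) * dft L g₂ (k₃ - p)) / (L : ℂ) ^ 2 ∧
    cfgDFT L (fun c => vfun L c * ((prod3 L g₁ g₂ g₃ c : ℝ) : ℂ)) k₂ k₃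
      = cfgDFT L (fun c => ((prod3 L g₁ g₂ g₃ c : ℝ) : ℂ)) k₂ k₃
        + cfgDFT L (fun c => ((prod3 L g₁ g₂ g₃ c : ℝ) : ℂ)) (k₂ - K1 L) k₃
        + cfgDFT L (fun c => ((prod3 L g₁ g₂ g₃ c : ℝ) : ℂ)) k₂ (k₃ - K1 L)

/-- the transforms of the two profile parts (ground profile): `f̂_JU(q) = aV[q=0] − a`, `f̂_S(q) = (V(1−a)+a)[q=0] − c_s g(q)`,
and `f_S = c_s a_λ` pointwise (`ground_profile_aKer`). -/
def ProfileTransforms (Δ : ℝ) : Prop :=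
  ∀ lam2 : ℝ, ∀ f : Tor L → ℝ, 5 ≤ L → 0 ≤ Δ → Δ < 1 → IsGroundTwoMagnon L Δ lam2 f → ∀ q : Tor L,
    dft L (fJU L Δ f) q = (((if q = 0 then Δ * f (K1 L) * (L : ℝ) ^ 2 else 0) - Δ * f (K1 L) : ℝ) : ℂ) ∧
    dft L (fS L Δ f) q
      = (((if q = 0 then (L : ℝ) ^ 2 * (1 - Δ * f (K1 L)) + Δ * f (K1 L) else 0) - cS L Δ lam2 f * gres L lam2 q : ℝ) : ℂ) ∧
    (∀ r : Tor L, fS L Δ f r = cS L Δ lam2 f * aKer L lam2 r)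

/-! ## §4 GENERIC EXPANSION of the §3 convolutions: closed δ-terms + trig-weighted propagator primitives (cycle22/calc/conv_expansion.py 2e-15) -/

/-- generic one-loop convolution of three momentum functions: `(1/V) Σ_p g₃(p) g₁(k₂+p) g₂(k₃−p)`. -/
def tconv (g₃ g₁ g₂ : Tor L → ℂ) (k₂ k₃ : Tor L) : ℂ := (∑ p : Tor L, g₃ p * g₁ (k₂ + p) * g₂ (k₃ - p)) / (L : ℂ) ^ 2

/-- ★ the transform of a lattice gradient: `FT[D_e F](q) = (1 − e^{−iq·e}) F̂(q)` (substitution `r ↦ r + e`). -/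
def DgradTransform : Prop :=
  ∀ F : Tor L → ℝ, ∀ e q : Tor L, dft L (fun r => Dgrad L F e r) q = (1 - (starRingEnd ℂ) (phase L q e)) * dft L F q

/-- ★ the full transform of a `c0form3` monomial (any three real profiles; `TripleConvolution` + `DgradTransform`; slot `a ↦ g₁`, `b ↦ g₂`, `b−a ↦ g₃`):
`cfgDFT[c0form3(Fa,Fb,Fc)](k) = −½ Σ_e [tconv(F̂c, d_eF̂a, d_eF̂b) + tconv(d_eF̂c, d_{−e}F̂a, F̂b) + tconv(d_eF̂c, F̂a, d_eF̂b)]`, `d_e(q) := 1 − e^{−iq·e}`;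
with `v`: add the two `K₁`-translates (`TripleConvolution` (ii)). -/
def C0MonoTransform : Prop :=
  ∀ Fa Fb Fc : Tor L → ℝ, ∀ k₂ k₃ : Tor L,
    cfgDFT L (fun c => ((c0form3 L Fa Fb Fc c : ℝ) : ℂ)) k₂ k₃
      = -(1 / 2) * ((nnList L).map (fun e =>
          tconv L (dft L Fc) (fun q => (1 - (starRingEnd ℂ) (phase L q e)) * dft L Fa q) (fun q => (1 - (starRingEnd ℂ) (phase L q e)) * dft L Fb q) k₂ k₃
        + tconv L (fun q => (1 - (starRingEnd ℂ) (phase L q e)) * dft L Fc q) (fun q => (1 - (starRingEnd ℂ) (phase L q (-e))) * dft L Fa q) (dft L Fb) k₂ k₃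
        + tconv L (fun q => (1 - (starRingEnd ℂ) (phase L q e)) * dft L Fc q) (dft L Fa) (fun q => (1 - (starRingEnd ℂ) (phase L q e)) * dft L Fb q) k₂ k₃)).sum

/-- ★ the full transform of an `mform3` monomial: pure translations of `Π̂_P := cfgDFT(prod3 Fa Fb Fc)` with `O(θ²)` prefactors (checked 1e-7 rel). -/
def MFormTransform : Prop :=
  ∀ Fa Fb Fc : Tor L → ℝ, ∀ k₂ k₃ : Tor L,
    cfgDFT L (mform3 L Fa Fb Fc) k₂ k₃
      = -(1 / 2) * (([ex L, -(ex L)] : List (Tor L)).map (fun e =>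
          (phase L (K1 L) e - 1) *
            ( ((starRingEnd ℂ) (phase L (k₂ + k₃) e) - 1) * cfgDFT L (fun c => ((prod3 L Fa Fb Fc c : ℝ) : ℂ)) k₂ k₃
            + (phase L (k₂ - K1 L) e - 1) * cfgDFT L (fun c => ((prod3 L Fa Fb Fc c : ℝ) : ℂ)) (k₂ - K1 L) k₃
            + (phase L (k₃ - K1 L) e - 1) * cfgDFT L (fun c => ((prod3 L Fa Fb Fc c : ℝ) : ℂ)) k₂ (k₃ - K1 L)))).sum

/-- weight factor of a slot: `none ↦ 1`, `some e ↦ 1 − e^{−iq·e}` (the `D_e` transform factor; vanishes at `q = 0`). -/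
def Wfac (w : Option (Tor L)) (q : Tor L) : ℂ :=
  match w with
  | none => 1
  | some e => 1 - (starRingEnd ℂ) (phase L q e)

/-- a FACTOR SPEC `φ = (w, α, β, γ)`: `F_φ(q) = Wfac w q · (αV[q = 0] + β + γ g(q))`.  By `ProfileTransforms`/`DgradTransform` every slot factor of a §3 monomial
is of this form: `JU ↦ (w, a, −a, 0)`, `S ↦ (w, 1 − a + a/V, 0, −c_s)`, `w = none | some (±e)`. -/
def Ffac (lam2 : ℝ) (φ : Option (Tor L) × ℝ × ℝ × ℝ) (q : Tor L) : ℂ :=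
  Wfac L φ.1 q * (((if q = 0 then φ.2.1 * (L : ℝ) ^ 2 else 0) + φ.2.2.1 + φ.2.2.2 * gres L lam2 q : ℝ) : ℂ)

/-- the regular part `Wfac w q · (β + γ g(q))`. -/
def Rfac (lam2 : ℝ) (φ : Option (Tor L) × ℝ × ℝ × ℝ) (q : Tor L) : ℂ :=
  Wfac L φ.1 q * ((φ.2.2.1 + φ.2.2.2 * gres L lam2 q : ℝ) : ℂ)

/-- ★ THE PRIMITIVE: trig-weighted propagator sum `E(r; S) := (1/V) Σ_p e^{−ip·r} Π_{s∈S} g(p + s)` (`S = []`: `[r = 0]`; real part = cos-weighted `B1.torSum`,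
imaginary part = sin-weighted; `|r|∞ ≤ 3`, shifts `∈ {0, k₂, −k₃}` on the low set). -/
def Eprim (lam2 : ℝ) (r : Tor L) (S : List (Tor L)) : ℂ :=
  (∑ p : Tor L, (starRingEnd ℂ) (phase L p r) * (S.map (fun s => ((gres L lam2 (p + s) : ℝ) : ℂ))).prod) / (L : ℂ) ^ 2

/-- the vector contributed by a weight under a subset choice: not chosen ↦ `some 0`; chosen ↦ the weight vector (or `none` if the slot is unweighted). -/
def optVec (b : Bool) (w : Option (Tor L)) : Option (Tor L) := if b then w else some 0

/-- the 8-pattern regular loop sum at weight-vector `r`: `Σ over (β|γ)³` of `Eprim r (shifts of the γ-slots)`, slots `3 ↦ 0`, `1 ↦ k₂`, `2 ↦ −k₃`. -/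
def loopPat (lam2 : ℝ) (φ₃ φ₁ φ₂ : Option (Tor L) × ℝ × ℝ × ℝ) (k₂ k₃ r : Tor L) : ℂ :=
  let b₃ : ℂ := ((φ₃.2.2.1 : ℝ) : ℂ); let c₃ : ℂ := ((φ₃.2.2.2 : ℝ) : ℂ)
  let b₁ : ℂ := ((φ₁.2.2.1 : ℝ) : ℂ); let c₁ : ℂ := ((φ₁.2.2.2 : ℝ) : ℂ)
  let b₂ : ℂ := ((φ₂.2.2.1 : ℝ) : ℂ); let c₂ : ℂ := ((φ₂.2.2.2 : ℝ) : ℂ)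
  b₃ * b₁ * b₂ * Eprim L lam2 r [] + c₃ * b₁ * b₂ * Eprim L lam2 r [0] + b₃ * c₁ * b₂ * Eprim L lam2 r [k₂] + b₃ * b₁ * c₂ * Eprim L lam2 r [-k₃]
  + c₃ * c₁ * b₂ * Eprim L lam2 r [0, k₂] + c₃ * b₁ * c₂ * Eprim L lam2 r [0, -k₃] + b₃ * c₁ * c₂ * Eprim L lam2 r [k₂, -k₃]
  + c₃ * c₁ * c₂ * Eprim L lam2 r [0, k₂, -k₃]

/-- the loop part: sum over subsets `A ⊆ {3,1,2}` of the present weights, sign `(−1)^{|A|}`, constant phase `e^{−i(k₂·r₁ + k₃·r₂)}`, vector `r_A = r₃ + r₁ − r₂`. -/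
def loopPart (lam2 : ℝ) (φ₃ φ₁ φ₂ : Option (Tor L) × ℝ × ℝ × ℝ) (k₂ k₃ : Tor L) : ℂ :=
  (([false, true].flatMap fun a₃ => [false, true].flatMap fun a₁ => [false, true].map fun a₂ =>
    match optVec L a₃ φ₃.1, optVec L a₁ φ₁.1, optVec L a₂ φ₂.1 with
    | some r₃, some r₁, some r₂ =>
        (if a₃ then (-1 : ℂ) else 1) * (if a₁ then (-1 : ℂ) else 1) * (if a₂ then (-1 : ℂ) else 1)
          * (starRingEnd ℂ) (phase L k₂ r₁) * (starRingEnd ℂ) (phase L k₃ r₂)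
          * loopPat L lam2 φ₃ φ₁ φ₂ k₂ k₃ (r₃ + r₁ - r₂)
    | _, _, _ => 0)).sum

/-- the seven closed δ-terms (at least one `αVδ` factor; `p` collapses). -/
def closedPart (lam2 : ℝ) (φ₃ φ₁ φ₂ : Option (Tor L) × ℝ × ℝ × ℝ) (k₂ k₃ : Tor L) : ℂ :=
  let V : ℂ := (L : ℂ) ^ 2
  let α₃ : ℂ := ((φ₃.2.1 : ℝ) : ℂ); let α₁ : ℂ := ((φ₁.2.1 : ℝ) : ℂ); let α₂ : ℂ := ((φ₂.2.1 : ℝ) : ℂ)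
  let d : Tor L → ℂ := fun q => if q = 0 then 1 else 0
  α₃ * α₁ * α₂ * V * V * d k₂ * d k₃ * Wfac L φ₃.1 0 * Wfac L φ₁.1 0 * Wfac L φ₂.1 0
  + α₃ * α₁ * V * d k₂ * Wfac L φ₃.1 0 * Wfac L φ₁.1 0 * Rfac L lam2 φ₂ k₃
  + α₃ * α₂ * V * d k₃ * Wfac L φ₃.1 0 * Wfac L φ₂.1 0 * Rfac L lam2 φ₁ k₂
  + α₁ * α₂ * V * d (k₂ + k₃) * Wfac L φ₁.1 0 * Wfac L φ₂.1 0 * Rfac L lam2 φ₃ (-k₂)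
  + α₃ * Wfac L φ₃.1 0 * Rfac L lam2 φ₁ k₂ * Rfac L lam2 φ₂ k₃
  + α₁ * Wfac L φ₁.1 0 * Rfac L lam2 φ₃ (-k₂) * Rfac L lam2 φ₂ (k₂ + k₃)
  + α₂ * Wfac L φ₂.1 0 * Rfac L lam2 φ₃ k₃ * Rfac L lam2 φ₁ (k₂ + k₃)

/-- ★ THE GENERIC EXPANSION (pure finite algebra, any `lam2`, any specs): `tconv(F_φ₃, F_φ₁, F_φ₂)(k₂,k₃) = closedPart + loopPart`.  Applied to the
`7 × 39` convolutions of `RhatCancelled` it leaves only: closed terms in `(a, c_s, V, θ, g at |q|∞ ≤ 3)` and primitives `Eprim r S` with `|r|∞ ≤ 3`,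
`|S| ≤ 3`, shifts in `{0, k₂, −k₃}` — each a cos/sin-weighted `B1.torSum` for p2's weighted bracket. -/
def ConvExpansion : Prop :=
  ∀ lam2 : ℝ, ∀ φ₃ φ₁ φ₂ : Option (Tor L) × ℝ × ℝ × ℝ, ∀ k₂ k₃ : Tor L,
    tconv L (Ffac L lam2 φ₃) (Ffac L lam2 φ₁) (Ffac L lam2 φ₂) k₂ k₃ = closedPart L lam2 φ₃ φ₁ φ₂ k₂ k₃ + loopPart L lam2 φ₃ φ₁ φ₂ k₂ k₃

/-! ### §4b UNIFORM VARIANT (no `Option`; equivalent, prove whichever is easier — conv_expansion_uniform.py 4e-15): a factor is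
`F_ψ(q) = (u + u′·e^{−iq·e})·(αV[q=0] + β + γ g(q))`, `ψ = (e, u, u′, α, β, γ)`; `(u,u′) = (1,0)` is an unweighted slot (any `e`), `(1,−1)` the
`D_e`-weighted slot.  The subset sum becomes a plain sum over `Bool³` with coefficients `u` / `u′` (zero coefficients kill absent weights). -/

/-- uniform factor spec `ψ = (e, u, u′, α, β, γ)`. -/
def FfacU (lam2 : ℝ) (ψ : Tor L × ℝ × ℝ × ℝ × ℝ × ℝ) (q : Tor L) : ℂ :=
  ((((ψ.2.1 : ℝ) : ℂ)) + ((ψ.2.2.1 : ℝ) : ℂ) * (starRingEnd ℂ) (phase L q ψ.1))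
    * (((if q = 0 then ψ.2.2.2.1 * (L : ℝ) ^ 2 else 0) + ψ.2.2.2.2.1 + ψ.2.2.2.2.2 * gres L lam2 q : ℝ) : ℂ)

/-- its regular part `(u + u′ e^{−iq·e})(β + γ g(q))`. -/
def RfacU (lam2 : ℝ) (ψ : Tor L × ℝ × ℝ × ℝ × ℝ × ℝ) (q : Tor L) : ℂ :=
  ((((ψ.2.1 : ℝ) : ℂ)) + ((ψ.2.2.1 : ℝ) : ℂ) * (starRingEnd ℂ) (phase L q ψ.1)) * ((ψ.2.2.2.2.1 + ψ.2.2.2.2.2 * gres L lam2 q : ℝ) : ℂ)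

/-- convert a uniform spec to the `(β, γ)` data `loopPat` needs (weights are handled outside): `(none, α, β, γ)`. -/
def toPat (ψ : Tor L × ℝ × ℝ × ℝ × ℝ × ℝ) : Option (Tor L) × ℝ × ℝ × ℝ := (none, ψ.2.2.2.1, ψ.2.2.2.2.1, ψ.2.2.2.2.2)

/-- uniform closed part: the 7 δ-terms with `W_i(0) = u_i + u′_i`. -/
def closedPartU (lam2 : ℝ) (ψ₃ ψ₁ ψ₂ : Tor L × ℝ × ℝ × ℝ × ℝ × ℝ) (k₂ k₃ : Tor L) : ℂ :=
  let V : ℂ := (L : ℂ) ^ 2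
  let α₃ : ℂ := ((ψ₃.2.2.2.1 : ℝ) : ℂ); let α₁ : ℂ := ((ψ₁.2.2.2.1 : ℝ) : ℂ); let α₂ : ℂ := ((ψ₂.2.2.2.1 : ℝ) : ℂ)
  let W₃ : ℂ := ((ψ₃.2.1 + ψ₃.2.2.1 : ℝ) : ℂ); let W₁ : ℂ := ((ψ₁.2.1 + ψ₁.2.2.1 : ℝ) : ℂ); let W₂ : ℂ := ((ψ₂.2.1 + ψ₂.2.2.1 : ℝ) : ℂ)
  let d : Tor L → ℂ := fun q => if q = 0 then 1 else 0
  α₃ * α₁ * α₂ * V * V * d k₂ * d k₃ * W₃ * W₁ * W₂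
  + α₃ * α₁ * V * d k₂ * W₃ * W₁ * RfacU L lam2 ψ₂ k₃
  + α₃ * α₂ * V * d k₃ * W₃ * W₂ * RfacU L lam2 ψ₁ k₂
  + α₁ * α₂ * V * d (k₂ + k₃) * W₁ * W₂ * RfacU L lam2 ψ₃ (-k₂)
  + α₃ * W₃ * RfacU L lam2 ψ₁ k₂ * RfacU L lam2 ψ₂ k₃
  + α₁ * W₁ * RfacU L lam2 ψ₃ (-k₂) * RfacU L lam2 ψ₂ (k₂ + k₃)
  + α₂ * W₂ * RfacU L lam2 ψ₃ k₃ * RfacU L lam2 ψ₁ (k₂ + k₃)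

/-- uniform loop part: plain sum over `Bool³`; slot `i` contributes `(u′_i, e_i)` if chosen else `(u_i, 0)`. -/
def loopPartU (lam2 : ℝ) (ψ₃ ψ₁ ψ₂ : Tor L × ℝ × ℝ × ℝ × ℝ × ℝ) (k₂ k₃ : Tor L) : ℂ :=
  (([false, true].flatMap fun a₃ => [false, true].flatMap fun a₁ => [false, true].map fun a₂ =>
    let c₃ : ℂ := if a₃ then ((ψ₃.2.2.1 : ℝ) : ℂ) else ((ψ₃.2.1 : ℝ) : ℂ)
    let c₁ : ℂ := if a₁ then ((ψ₁.2.2.1 : ℝ) : ℂ) else ((ψ₁.2.1 : ℝ) : ℂ)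
    let c₂ : ℂ := if a₂ then ((ψ₂.2.2.1 : ℝ) : ℂ) else ((ψ₂.2.1 : ℝ) : ℂ)
    let r₃ : Tor L := if a₃ then ψ₃.1 else 0
    let r₁ : Tor L := if a₁ then ψ₁.1 else 0
    let r₂ : Tor L := if a₂ then ψ₂.1 else 0
    c₃ * c₁ * c₂ * (starRingEnd ℂ) (phase L k₂ r₁) * (starRingEnd ℂ) (phase L k₃ r₂)
      * loopPat L lam2 (toPat L ψ₃) (toPat L ψ₁) (toPat L ψ₂) k₂ k₃ (r₃ + r₁ - r₂))).sum

/-- ★ uniform expansion: `tconv(F_ψ₃, F_ψ₁, F_ψ₂) = closedPartU + loopPartU` for ANY real `(u, u′)` (multilinear in the weight data). -/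
def ConvExpansionU : Prop :=
  ∀ lam2 : ℝ, ∀ ψ₃ ψ₁ ψ₂ : Tor L × ℝ × ℝ × ℝ × ℝ × ℝ, ∀ k₂ k₃ : Tor L,
    tconv L (FfacU L lam2 ψ₃) (FfacU L lam2 ψ₁) (FfacU L lam2 ψ₂) k₂ k₃ = closedPartU L lam2 ψ₃ ψ₁ ψ₂ k₂ k₃ + loopPartU L lam2 ψ₃ ψ₁ ψ₂ k₂ k₃

/-- dictionary between the two spec languages: `Ffac (none, α, β, γ) = FfacU (e, 1, 0, α, β, γ)` (any `e`), `Ffac (some e, α, β, γ) = FfacU (e, 1, −1, α, β, γ)`. -/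
def FfacDictionary : Prop :=
  ∀ lam2 α β γ : ℝ, ∀ e q : Tor L,
    Ffac L lam2 (none, α, β, γ) q = FfacU L lam2 (e, 1, 0, α, β, γ) q ∧
    Ffac L lam2 (some e, α, β, γ) q = FfacU L lam2 (e, 1, -1, α, β, γ) q

/-- symmetries of the primitive (cut the 245 raw `(r, S)` of the row-D inventory to ≤ 43 brackets; rowD_inventory.py): common translation of the
shifts is a phase, `E(r; S + t) = e^{+it·r} E(r; S)`; joint inversion is trivial, `E(−r; −S) = E(r; S)` (`g` even); conjugation flips `r`,
`conj E(r; S) = E(−r; S)`; and `E` is covariant under the lattice point group acting on `(r, S)` jointly. -/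
def EprimSymmetries : Prop :=
  ∀ lam2 : ℝ, ∀ r t : Tor L, ∀ S : List (Tor L),
    Eprim L lam2 r (S.map (fun s => s + t)) = phase L t r * Eprim L lam2 r S ∧
    Eprim L lam2 (-r) (S.map (fun s => -s)) = Eprim L lam2 r S ∧
    (starRingEnd ℂ) (Eprim L lam2 r S) = Eprim L lam2 (-r) S ∧
    Eprim L lam2 (r.2, r.1) (S.map (fun s => (s.2, s.1))) = Eprim L lam2 r S ∧
    Eprim L lam2 (-r.1, r.2) (S.map (fun s => (-s.1, s.2))) = Eprim L lam2 r S

/-- the slot specs of the ground profile (`ProfileTransforms` + `DgradTransform`): `F̂_JU = F_(none,a,−a,0)`, `F̂_S = F_(none,1−a+a/V,0,−c_s)`,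
and a `d_{±e}` weight just sets the first component to `some (±e)`. -/
def SlotSpecs (Δ : ℝ) : Prop :=
  ∀ lam2 : ℝ, ∀ f : Tor L → ℝ, 5 ≤ L → 0 ≤ Δ → Δ < 1 → IsGroundTwoMagnon L Δ lam2 f → ∀ w : Option (Tor L), ∀ q : Tor L,
    Wfac L w q * dft L (fJU L Δ f) q = Ffac L lam2 (w, Δ * f (K1 L), -(Δ * f (K1 L)), 0) q ∧
    Wfac L w q * dft L (fS L Δ f) q = Ffac L lam2 (w, 1 - Δ * f (K1 L) + Δ * f (K1 L) / (L : ℝ) ^ 2, 0, -cS L Δ lam2 f) q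

/-! ## §5 THE D-BOUNDARY SUMS in named form (pair transforms; cycle22/calc/boundary_lines.py 1e-14) -/

/-- pair transform `Z(F,G)(q) := FT[F·G](q)` (= `(1/V) Σ_p F̂(p) Ĝ(q−p)`, `PairConvolution`; `Yfun`, `phiHat`, `F2` are instances). -/
def pairZ (F G : Tor L → ℝ) (q : Tor L) : ℂ := dft L (fun r => F r * G r) q

/-- ★ `FT[F·G](q) = (1/V) Σ_p F̂(p) Ĝ(q − p)`. -/
def PairConvolution : Prop :=
  ∀ F G : Tor L → ℝ, ∀ q : Tor L, pairZ L F G q = (∑ p : Tor L, dft L F p * dft L G (q - p)) / (L : ℂ) ^ 2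

/-- ★ shift transforms: `FT[G(· − e)](q) = e^{−iq·e} Ĝ(q)`, `FT[G(· + e)](q) = e^{+iq·e} Ĝ(q)` (and `FT[D_eG] = (1 − e^{−iq·e})Ĝ`, `DgradTransform`). -/
def ShiftTransform : Prop :=
  ∀ G : Tor L → ℝ, ∀ e q : Tor L,
    dft L (fun r => G (r - e)) q = (starRingEnd ℂ) (phase L q e) * dft L G q ∧
    dft L (fun r => G (r + e)) q = phase L q e * dft L G q

/-- line `a = 0`, `C0` part: `C_A(q) = ½ Σ_e [Fa(−e)·Z(Fc, D_eFb)(q) + Fa(e)·Z(Fb, D_eFc)(q)]`. -/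
def bCA (Fa Fb Fc : Tor L → ℝ) (q : Tor L) : ℂ :=
  (1 / 2) * ((nnList L).map (fun e =>
    ((Fa (-e) : ℝ) : ℂ) * pairZ L Fc (fun r => Dgrad L Fb e r) q + ((Fa e : ℝ) : ℂ) * pairZ L Fb (fun r => Dgrad L Fc e r) q)).sum

/-- line `a = 0`, spectator part: `M_A(q) = −½ Σ_{e=±x̂} (e^{iK₁·e} − 1)[Fa(−e)·Z(Fb(·−e), Fc)(q) + Fa(e)·Z(Fb, Fc(·−e))(q)]`. -/
def bMA (Fa Fb Fc : Tor L → ℝ) (q : Tor L) : ℂ :=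
  -(1 / 2) * (([ex L, -(ex L)] : List (Tor L)).map (fun e => (phase L (K1 L) e - 1) *
    (((Fa (-e) : ℝ) : ℂ) * pairZ L (fun r => Fb (r - e)) Fc q + ((Fa e : ℝ) : ℂ) * pairZ L Fb (fun r => Fc (r - e)) q))).sum

/-- line `b = 0`, `C0` part: `C_B(q) = ½ Σ_e Fb(−e)·[Z(Fc, D_eFa)(q) + Z(Fa, D_{−e}Fc)(q)]`. -/
def bCB (Fa Fb Fc : Tor L → ℝ) (q : Tor L) : ℂ :=
  (1 / 2) * ((nnList L).map (fun e =>
    ((Fb (-e) : ℝ) : ℂ) * (pairZ L Fc (fun r => Dgrad L Fa e r) q + pairZ L Fa (fun r => Dgrad L Fc (-e) r) q))).sum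

/-- line `b = 0`, spectator part: `M_B(q) = −½ Σ_{e=±x̂} (e^{iK₁·e} − 1)[Fb(−e)·Z(Fa(·−e), Fc)(q) + Fb(e)·Z(Fa, Fc(·−e))(q)]`. -/
def bMB (Fa Fb Fc : Tor L → ℝ) (q : Tor L) : ℂ :=
  -(1 / 2) * (([ex L, -(ex L)] : List (Tor L)).map (fun e => (phase L (K1 L) e - 1) *
    (((Fb (-e) : ℝ) : ℂ) * pairZ L (fun r => Fa (r - e)) Fc q + ((Fb e : ℝ) : ℂ) * pairZ L Fa (fun r => Fc (r - e)) q))).sum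

/-- diagonal `a = b`, `C0` part: `C_D(q) = ½ Σ_e Fc(−e)·[Z(Fb, D_{−e}Fa)(q) + Z(Fa, D_eFb)(q)]`. -/
def bCD (Fa Fb Fc : Tor L → ℝ) (q : Tor L) : ℂ :=
  (1 / 2) * ((nnList L).map (fun e =>
    ((Fc (-e) : ℝ) : ℂ) * (pairZ L Fb (fun r => Dgrad L Fa (-e) r) q + pairZ L Fa (fun r => Dgrad L Fb e r) q))).sum

/-- diagonal `a = b`, spectator part: `M_D(q) = −½ Σ_{e=±x̂} (e^{iK₁·e} − 1)[Fc(−e)·Z(Fa(·+e), Fb)(q) + Fc(e)·Z(Fa, Fb(·+e))(q)]`. -/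
def bMD (Fa Fb Fc : Tor L → ℝ) (q : Tor L) : ℂ :=
  -(1 / 2) * (([ex L, -(ex L)] : List (Tor L)).map (fun e => (phase L (K1 L) e - 1) *
    (((Fc (-e) : ℝ) : ℂ) * pairZ L (fun r => Fa (r + e)) Fb q + ((Fc e : ℝ) : ℂ) * pairZ L Fa (fun r => Fb (r + e)) q))).sum

/-- ★ THE BOUNDARY SUMS (the `D`-part subtracted in `OffDTransform`, for `G = v·c0form3(P) + mform3(P)`; even profiles vanishing at the origin —
`fJU`, `fS` of an even `f` qualify): corner `G(0,0) = 0`, and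
`Σ_{D-lines} = [2C_A(k₃) + C_A(k₃−K₁) + M_A(k₃)] + [2C_B(k₂) + C_B(k₂−K₁) + M_B(k₂)] + [C_D(k₂+k₃) + 2C_D(k₂+k₃−K₁) + M_D(k₂+k₃−K₁)]`;
with `PairConvolution` + `ShiftTransform` + `DgradTransform` + `SlotSpecs` every `Z` is a two-factor spec convolution = closed + `Eprim r S`, `|S| ≤ 2`. -/
def BoundaryLines : Prop :=
  ∀ Fa Fb Fc : Tor L → ℝ, (∀ r, Fa (-r) = Fa r) → (∀ r, Fb (-r) = Fb r) → (∀ r, Fc (-r) = Fc r) → Fa 0 = 0 → Fb 0 = 0 → Fc 0 = 0 →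
    ∀ k₂ k₃ : Tor L,
      let G : Cfg L → ℂ := fun c => vfun L c * ((c0form3 L Fa Fb Fc c : ℝ) : ℂ) + mform3 L Fa Fb Fc c
      G (0, 0) = 0 ∧
      ((∑ b : Tor L, (starRingEnd ℂ) (phase L k₃ b) * G (0, b))
        + (∑ a : Tor L, (starRingEnd ℂ) (phase L k₂ a) * G (a, 0))
        + (∑ a : Tor L, (starRingEnd ℂ) (phase L k₂ a * phase L k₃ a) * G (a, a)))
      = (2 * bCA L Fa Fb Fc k₃ + bCA L Fa Fb Fc (k₃ - K1 L) + bMA L Fa Fb Fc k₃)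
        + (2 * bCB L Fa Fb Fc k₂ + bCB L Fa Fb Fc (k₂ - K1 L) + bMB L Fa Fb Fc k₂)
        + (bCD L Fa Fb Fc (k₂ + k₃) + 2 * bCD L Fa Fb Fc (k₂ + k₃ - K1 L) + bMD L Fa Fb Fc (k₂ + k₃ - K1 L))

/-- the slot profiles qualify: for an even `f`, `fJU` and `fS` are even and vanish at the origin. -/
def SlotsEvenZero (Δ : ℝ) : Prop :=
  ∀ f : Tor L → ℝ, (∀ r, f (-r) = f r) → f 0 = 0 →
    (∀ r, fJU L Δ f (-r) = fJU L Δ f r) ∧ (∀ r, fS L Δ f (-r) = fS L Δ f r) ∧ fJU L Δ f 0 = 0 ∧ fS L Δ f 0 = 0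

end Summit.HubbardSuperconductivity.HubbardSuperconductivity.Theorems.AnisotropyChord.Transfer.Fibre3

end
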